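import Summits.BirchSwinnertonDyer.BirchSwinnertonDyer.Theorems.KolyvaginRoadThreePTDescentDictionary
import Summits.BirchSwinnertonDyer.BirchSwinnertonDyer.Theorems.KolyvaginRoadThreePTDescentLocalDataDual
import Literature.NumberTheory.GaloisRepresentations.ContinuousCorestrictionTransport
import Literature.NumberTheory.GaloisRepresentations.ContinuousCorestrictionDoubleCosetFinite
import HarnessLib

/-!
# The semi-local compatibility `loc_v ∘ Cor_{K'/K} = Σ_{w ∣ v} Cor_{w/v} ∘ loc_w` (binder (N2) `hsemi`)

Route `KolyvaginRoadThree`, crux `ZhangSharpFrameAtThreeHL` (stmt-BirchSwinnertonDyer-19574), PT road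
(C).  Discharges the binder `hsemi` of `middleExact_canonical_of_descentData` (p555478) for
`ρ' = ρ|_{Γ_{K'}}`, `CorG = galoisCohomology.cor ρ K'`, `Cor v w = localCor v w ρ`:

  `loc_v (Cor_{K'/K} y') = Σ_{w ∣ v} Cor_{w/v} (loc_w y')`     (`localization_cor_eq_sum_localCor`).

Proof: transport to the decomposition group `D_v = res(Γ_{K_v}) ≤ Γ_K`
(`completionRangeTransport`, under which `loc_v` becomes `res_{D_v}`,
`completionRangeTransport_localization`), apply the double-coset formula
`resSubgroup_cores_eq_sum_cores_conjRes` (p552734) with the dictionary of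
`KolyvaginRoadThreePTDescentDictionary` (`hcov_place`, `hdisj_place`, `D'_w = interConj H D_v τ_w⁻¹`),
and identify the summand at `w` with the transport of `Cor_{w/v} ∘ twist⁻¹ ∘ loc_w`
(`cores_map_eq_map_cores`, p561206; `cores_congr` along `D'_w = θ⁻¹(res_{w/v} Γ_{K'_w})`; and an
explicit comparison of `1`-cocycles, whose only non-formal input is the group-theoretic identity
`e_{K'}⁻¹(τ_w d τ_w⁻¹) = res_{w/K'}(e_{w/v}⁻¹(θ d))`, i.e. `conjugator_spec`).

THEOREMS only (no definition, no named fact, no instance); no case of BSD.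

References: [NeukirchSchmidtWingberg2008] I §5 (1.5.6)–(1.5.7); [SerreGaloisCohomology1997] I §2.4,
II §6.1; [CasselsFrohlichANT1967] Ch. II §10.
-/

noncomputable section

open CategoryTheory Function NumberField IsDedekindDomain
open scoped NumberField Classical

set_option linter.dupNamespace false
set_option autoImplicit false

namespace Summit.BirchSwinnertonDyer.BirchSwinnertonDyer.Theorems.KolyvaginRoadThreePT

open Field
open Literature.NumberTheory.GaloisRepresentations Literature.NumberTheory.GaloisCohomology
open Literature.NumberTheory.GaloisRepresentations.SemiLocal (Place algebraPlace)
open Literature.NumberTheory.NumberFields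

/-! ## `cores` along equal subgroups -/

section CoresCongr

universe u v

variable {R : Type u} [Ring R] [TopologicalSpace R]
variable {G : Type v} [Group G] [TopologicalSpace G] [IsTopologicalGroup G]

/-- `cores` along equal open subgroups agree, after the tautological restriction `resLe` along the
equality (which is the identity on cocycles). [cite: SerreGaloisCohomology1997, I §2.4] -/
theorem cores_congr (X : TopRep.{v} R G) {N₁ N₂ : Subgroup G} (e : N₁ = N₂)
    [i₁ : Fintype (G ⧸ N₁)] [i₂ : Fintype (G ⧸ N₂)]
    (h₁ : IsOpen (N₁ : Set G)) (h₂ : IsOpen (N₂ : Set G))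
    (z : continuousCohomology 1 (subgroupRep X N₂)) :
    cores X N₁ h₁ (resLe X e.le 1 z) = cores X N₂ h₂ z := by
  subst e
  have hi : i₁ = i₂ := Subsingleton.elim _ _
  subst hi
  congr 1
  obtain ⟨φ, rfl⟩ := oneCocycleClass_surjective _ z
  rw [resLe_oneCocycleClass]
  exact congrArg _ (Subtype.ext (ContinuousMap.ext fun _ => rfl))

end CoresCongr

section SemiLocal

variable {K K' : Type} [Field K] [NumberField K] [Field K'] [NumberField K'] [Algebra K K']
variable {M : Type} [AddCommGroup M] [TopologicalSpace M] [DiscreteTopology M]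
variable (v : HeightOneSpectrum (𝓞 K)) (w : Place K K' v) (ρ : DiscreteGaloisModule K M)

/-- **`D'_w = θ⁻¹(res_{w/v} Γ_{K'_w})`** for `θ : D_v ≅ Γ_{K_v}` the inverse of
`absGaloisRangeEquivCompletion` (comap form of `mem_subgroupOf_interConj_iff`).
[cite: CasselsFrohlichANT1967, Ch. II §10] -/
theorem subgroupOf_interConj_eq_comap_range :
    (interConj (absGaloisRestrict K K').range (absGaloisRestrict K (v.adicCompletion K)).range
        (conjugator v w)⁻¹).subgroupOf (absGaloisRestrict K (v.adicCompletion K)).range =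
      ((absGaloisRestrict (v.adicCompletion K) ((w : HeightOneSpectrum (𝓞 K')).adicCompletion K')).range).comap
        ((((absGaloisRangeEquivCompletion K v).symm :
            (absGaloisRestrict K (v.adicCompletion K)).range →ₜ* absoluteGaloisGroup (v.adicCompletion K)) :
          (absGaloisRestrict K (v.adicCompletion K)).range →* absoluteGaloisGroup (v.adicCompletion K))) := by
  ext d
  rw [mem_subgroupOf_interConj_iff, Subgroup.mem_comap]
  constructor
  · rintro ⟨σ, hσ⟩
    refine ⟨σ, absGaloisRestrict_adicCompletion_injective K v ?_⟩
    change absGaloisRestrict K (v.adicCompletion K) _ =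
      absGaloisRestrict K (v.adicCompletion K) ((absGaloisRangeEquivCompletion K v).symm d)
    rw [absGaloisRestrict_absGaloisRangeEquivCompletion_symm]
    exact hσ
  · rintro ⟨σ, hσ⟩
    refine ⟨σ, ?_⟩
    have hσ' : absGaloisRestrict (v.adicCompletion K) ((w : HeightOneSpectrum (𝓞 K')).adicCompletion K') σ =
        (absGaloisRangeEquivCompletion K v).symm d := hσ
    rw [hσ', absGaloisRestrict_absGaloisRangeEquivCompletion_symm]


/-- **The summand at `w` of the double-coset formula is the transport of `Cor_{w/v} ∘ twist⁻¹ ∘ loc_w`**: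
for `y' ∈ H¹(K', M)`, with `X = M` as a `Γ_K`-module, `D_v = res(Γ_{K_v})`, `H = res(Γ_{K'})`,
`τ = τ_w`, `D'_w = interConj H D_v τ⁻¹`,

  `cor_{D_v/D'_w} ((τ⁻¹)_* res (transport y')) = T_v (Cor_{w/v} (twist⁻¹ (loc_w y')))`

in `H¹(D_v, M)`, where `T_v : H¹(K_v, M) ≅ H¹(D_v, M)` is `completionRangeTransport`.
[cite: NeukirchSchmidtWingberg2008, I §5 (1.5.6)–(1.5.7)] [cite: SerreGaloisCohomology1997, I §2.4] -/
theorem cores_conjRes_rangeTransport_eq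
    [Fintype ((absGaloisRestrict K (v.adicCompletion K)).range ⧸
      (interConj (absGaloisRestrict K K').range (absGaloisRestrict K (v.adicCompletion K)).range
        (conjugator v w)⁻¹).subgroupOf (absGaloisRestrict K (v.adicCompletion K)).range)]
    (hH : IsOpen ((absGaloisRestrict K K').range : Set (absoluteGaloisGroup K)))
    (y' : galoisCohomology (ρ.restrictField K') 1) :
    cores (subgroupRep ρ.toTopRep (absGaloisRestrict K (v.adicCompletion K)).range)
        ((interConj (absGaloisRestrict K K').range (absGaloisRestrict K (v.adicCompletion K)).range
          (conjugator v w)⁻¹).subgroupOf (absGaloisRestrict K (v.adicCompletion K)).range)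
        (isOpen_interConj_subgroupOf (absGaloisRestrict K K').range
          (absGaloisRestrict K (v.adicCompletion K)).range hH (conjugator v w)⁻¹)
        (toSubgroupOf ρ.toTopRep
          (interConj_le (absGaloisRestrict K K').range (absGaloisRestrict K (v.adicCompletion K)).range
            (conjugator v w)⁻¹) 1
          (conjRes (absGaloisRestrict K K').range (conjugator v w)⁻¹
            (interConj (absGaloisRestrict K K').range (absGaloisRestrict K (v.adicCompletion K)).range
              (conjugator v w)⁻¹)
            (fun a ha => ((mem_interConj (absGaloisRestrict K K').range
              (absGaloisRestrict K (v.adicCompletion K)).range (conjugator v w)⁻¹ a).mp ha).2)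
            ρ.toTopRep 1 (galoisCohomology.rangeTransport ρ K' 1 y'))) =
      galoisCohomology.completionRangeTransport v ρ 1
        (localCor v w ρ (galoisCohomology.localization (ρ.restrictField K') (Sum.inr ↑w) 1 y')) := by
  classical
  haveI := LocalField.charZero_adicCompletion v
  haveI := finiteDimensional_place' v w
  have hEq := subgroupOf_interConj_eq_comap_range v w
  -- the transport `θ : D_v ≅ Γ_{K_v}` and the subgroup `N_w = res_{w/v}(Γ_{K'_w})`
  set Nw := (absGaloisRestrict (v.adicCompletion K) ((w : HeightOneSpectrum (𝓞 K')).adicCompletion K')).range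
    with hNw
  set θ : (absGaloisRestrict K (v.adicCompletion K)).range →ₜ* absoluteGaloisGroup (v.adicCompletion K) :=
    ((absGaloisRangeEquivCompletion K v).symm :
      (absGaloisRestrict K (v.adicCompletion K)).range →ₜ* absoluteGaloisGroup (v.adicCompletion K)) with hθ
  have hθbij : Function.Bijective θ := (absGaloisRangeEquivCompletion K v).symm.bijective
  have hNw_open : IsOpen (Nw : Set (absoluteGaloisGroup (v.adicCompletion K))) :=
    isOpen_range_absGaloisRestrict _ _
  have hN'_open : IsOpen ((Nw.comap (θ : (absGaloisRestrict K (v.adicCompletion K)).range →*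
      absoluteGaloisGroup (v.adicCompletion K))) : Set (absGaloisRestrict K (v.adicCompletion K)).range) :=
    hNw_open.preimage θ.continuous
  -- finiteness of `D_v ⧸ θ⁻¹ N_w`
  haveI : (Nw.comap (θ : (absGaloisRestrict K (v.adicCompletion K)).range →*
      absoluteGaloisGroup (v.adicCompletion K))).FiniteIndex := ⟨by
    rw [← hEq, index_interConj_subgroupOf]
    exact Module.finrank_pos.ne'⟩
  letI iN' : Fintype ((absGaloisRestrict K (v.adicCompletion K)).range ⧸
      Nw.comap (θ : (absGaloisRestrict K (v.adicCompletion K)).range →* absoluteGaloisGroup (v.adicCompletion K))) :=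
    Fintype.ofFinite _
  letI iNw : Fintype (absoluteGaloisGroup (v.adicCompletion K) ⧸ Nw) := Fintype.ofFinite _
  -- unfold the right-hand side and move `cores` across the transport
  rw [localCor_apply, galoisCohomology.cor_eq_cores_rangeTransport,
    galoisCohomology.completionRangeTransport_apply]
  have hT := cores_map_eq_map_cores
    (DiscreteGaloisModule.toTopRep (GaloisRep.toLocal v ρ))
    (subgroupRep ρ.toTopRep (absGaloisRestrict K (v.adicCompletion K)).range) θ hθbij
    (completionRangeTransportHom v ρ) Nw hNw_open hN'_open
    (galoisCohomology.rangeTransport (GaloisRep.toLocal v ρ)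
      ((w : HeightOneSpectrum (𝓞 K')).adicCompletion K') 1
      ((twist v w ρ).symm (galoisCohomology.localization (ρ.restrictField K') (Sum.inr ↑w) 1 y')))
  change _ = ContinuousCohomology.map θ (completionRangeTransportHom v ρ) 1 (cores _ Nw _ _)
  rw [← hT, ← cores_congr (subgroupRep ρ.toTopRep (absGaloisRestrict K (v.adicCompletion K)).range) hEq
    (isOpen_interConj_subgroupOf (absGaloisRestrict K K').range
      (absGaloisRestrict K (v.adicCompletion K)).range hH (conjugator v w)⁻¹) hN'_open]
  congr 1
  -- compare the two classes on cocycles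
  obtain ⟨φ, rfl⟩ := oneCocycleClass_surjective (DiscreteGaloisModule.toTopRep (ρ.restrictField K')) y'
  -- push the class through every map (all are `ContinuousCohomology.map` of compatible pairs)
  have e1 : galoisCohomology.rangeTransport ρ K' 1
      (oneCocycleClass (DiscreteGaloisModule.toTopRep (ρ.restrictField K')) φ) =
      oneCocycleClass _ (contOneCocycles.pullback
        ((absGaloisRangeEquiv K K').symm : (absGaloisRestrict K K').range →ₜ* absoluteGaloisGroup K')
        (rangeTransportHom ρ K') φ) := map_oneCocycleClass _ _ _ _
  have e2 : ∀ c, (toSubgroupOf ρ.toTopRep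
      (interConj_le (absGaloisRestrict K K').range (absGaloisRestrict K (v.adicCompletion K)).range
        (conjugator v w)⁻¹) 1) (oneCocycleClass _ c) =
      oneCocycleClass _ (contOneCocycles.pullback (subgroupOfHom
        (interConj_le (absGaloisRestrict K K').range (absGaloisRestrict K (v.adicCompletion K)).range
          (conjugator v w)⁻¹)) _ c) := fun c => map_oneCocycleClass _ _ _ _
  have e3 : galoisCohomology.localization (ρ.restrictField K') (Sum.inr ↑w) 1
      (oneCocycleClass (DiscreteGaloisModule.toTopRep (ρ.restrictField K')) φ) =
      oneCocycleClass (DiscreteGaloisModule.toTopRep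
        (GaloisRep.toLocal (↑w : HeightOneSpectrum (𝓞 K')) (ρ.restrictField K'))) (contOneCocycles.pullback
        (absGaloisRestrict K' ((w : HeightOneSpectrum (𝓞 K')).adicCompletion K')) _ φ) :=
    map_oneCocycleClass _ _ _ _
  have e4 : ∀ c, galoisCohomology.map (twistInv v w ρ) 1 (oneCocycleClass _ c) =
      oneCocycleClass _ (contOneCocycles.pullback (ContinuousMonoidHom.id _) _ c) :=
    fun c => map_oneCocycleClass _ _ _ _
  have e5 : ∀ c, galoisCohomology.rangeTransport (GaloisRep.toLocal v ρ)
      ((w : HeightOneSpectrum (𝓞 K')).adicCompletion K') 1 (oneCocycleClass _ c) =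
      oneCocycleClass _ (contOneCocycles.pullback
        ((absGaloisRangeEquiv (v.adicCompletion K) ((w : HeightOneSpectrum (𝓞 K')).adicCompletion K')).symm :
          Nw →ₜ* absoluteGaloisGroup ((w : HeightOneSpectrum (𝓞 K')).adicCompletion K'))
        (rangeTransportHom (GaloisRep.toLocal v ρ) ((w : HeightOneSpectrum (𝓞 K')).adicCompletion K')) c) :=
    fun c => map_oneCocycleClass _ _ _ _
  rw [e1, conjRes_oneCocycleClass, e2, e3, twist_symm_apply, e4, e5, map_oneCocycleClass,
    resLe_oneCocycleClass]
  refine congrArg _ (Subtype.ext (ContinuousMap.ext fun d => ?_))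
  show ρ (conjugator v w)⁻¹ (φ.1 _) = ρ (conjugator v w)⁻¹ (φ.1 _)
  refine congrArg (fun γ => ρ (conjugator v w)⁻¹ (φ.1 γ)) ?_
  -- the group-theoretic identity `e_{K'}⁻¹(τ d τ⁻¹) = res_{w/K'}(e_{w/v}⁻¹(θ d))`
  apply absGaloisRestrict_injective K K'
  change absGaloisRestrict K K' ((absGaloisRangeEquiv K K').symm _) =
    absGaloisRestrict K K' (absGaloisRestrict K' ((w : HeightOneSpectrum (𝓞 K')).adicCompletion K')
      ((absGaloisRangeEquiv (v.adicCompletion K) ((w : HeightOneSpectrum (𝓞 K')).adicCompletion K')).symm _))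
  rw [absGaloisRestrict_absGaloisRangeEquiv_symm, conjugator_spec, absGaloisRestrict_absGaloisRangeEquiv_symm]
  have hle := interConj_le (absGaloisRestrict K K').range (absGaloisRestrict K (v.adicCompletion K)).range
    (conjugator v w)⁻¹
  have hA : ∀ a ∈ interConj (absGaloisRestrict K K').range (absGaloisRestrict K (v.adicCompletion K)).range
      (conjugator v w)⁻¹, (conjugator v w)⁻¹⁻¹ * a * (conjugator v w)⁻¹ ∈ (absGaloisRestrict K K').range :=
    fun a ha => ((mem_interConj _ _ _ a).mp ha).2
  change ((conjResHom (absGaloisRestrict K K').range (conjugator v w)⁻¹ _ hA (subgroupOfHom hle d) :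
      (absGaloisRestrict K K').range) : absoluteGaloisGroup K) =
    conjugator v w * absGaloisRestrict K (v.adicCompletion K)
      ((comapRestrictHom θ Nw (Literature.NumberTheory.EllipticCurves.subgroupInclusion hEq.le d) : Nw) :
        absoluteGaloisGroup (v.adicCompletion K)) * (conjugator v w)⁻¹
  rw [conjResHom_apply_coe, subgroupOfHom_apply_coe, comapRestrictHom_apply_coe, inv_inv]
  congr 2
  change _ = absGaloisRestrict K (v.adicCompletion K) ((absGaloisRangeEquivCompletion K v).symm _)
  rw [absGaloisRestrict_absGaloisRangeEquivCompletion_symm]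
  rfl


/-- **(N2) The semi-local compatibility `loc_v ∘ Cor_{K'/K} = Σ_{w ∣ v} Cor_{w/v} ∘ loc_w`** for the
restricted module `ρ|_{Γ_{K'}}` and the local corestrictions `localCor v w ρ` (the binder `hsemi` of
`middleExact_canonical_of_descentData`): the double-coset formula for `res_{D_v} ∘ cor_{Γ_K/H}`
(`resSubgroup_cores_eq_sum_cores_conjRes`) with the dictionary `D_v \ Γ_K / H ↔ {w ∣ v}`
(`hcov_place`, `hdisj_place`), summand by summand (`cores_conjRes_rangeTransport_eq`).
[cite: NeukirchSchmidtWingberg2008, I §5 (1.5.6)–(1.5.7)] [cite: CasselsFrohlichANT1967, Ch. II §10] -/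
theorem localization_cor_eq_sum_localCor (y' : galoisCohomology (ρ.restrictField K') 1) :
    galoisCohomology.localization ρ (Sum.inr v) 1 (galoisCohomology.cor ρ K' y') =
      ∑ w : Place K K' v, localCor v w ρ
        (galoisCohomology.localization (ρ.restrictField K') (Sum.inr ↑w) 1 y') := by
  classical
  haveI : FiniteDimensional K K' := Module.Finite.of_restrictScalars_finite ℚ K K'
  letI : Fintype (absoluteGaloisGroup K ⧸ (absGaloisRestrict K K').range) := Fintype.ofFinite _
  haveI : ∀ w : Place K K' v, Finite ((absGaloisRestrict K (v.adicCompletion K)).range ⧸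
      (interConj (absGaloisRestrict K K').range (absGaloisRestrict K (v.adicCompletion K)).range
        (conjugator v w)⁻¹).subgroupOf (absGaloisRestrict K (v.adicCompletion K)).range) :=
    fun w => finite_quotient_interConj_subgroupOf _ _ _
  letI : ∀ w : Place K K' v, Fintype ((absGaloisRestrict K (v.adicCompletion K)).range ⧸
      (interConj (absGaloisRestrict K K').range (absGaloisRestrict K (v.adicCompletion K)).range
        (conjugator v w)⁻¹).subgroupOf (absGaloisRestrict K (v.adicCompletion K)).range) :=
    fun w => Fintype.ofFinite _
  apply (galoisCohomology.completionRangeTransport v ρ 1).injective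
  rw [galoisCohomology.completionRangeTransport_localization, galoisCohomology.cor_eq_cores_rangeTransport,
    map_sum, resSubgroup_cores_eq_sum_cores_conjRes ρ.toTopRep (absGaloisRestrict K K').range
      (absGaloisRestrict K (v.adicCompletion K)).range (fun w : Place K K' v => (conjugator v w)⁻¹)
      (fun w => interConj (absGaloisRestrict K K').range (absGaloisRestrict K (v.adicCompletion K)).range
        (conjugator v w)⁻¹)
      (fun w => interConj_le _ _ _) (fun w a ha => ha.2) (fun w a haD h => ⟨haD, h⟩)
      (hcov_place v) (hdisj_place v) (isOpen_range_absGaloisRestrict K K')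
      (fun w => isOpen_interConj_subgroupOf _ _ (isOpen_range_absGaloisRestrict K K') _)]
  exact Finset.sum_congr rfl fun w _ =>
    cores_conjRes_rangeTransport_eq v w ρ (isOpen_range_absGaloisRestrict K K') y'


/-- **(N2, dual side) `loc_v ∘ Cor^D = Σ_{w ∣ v} Cor^D_{w/v} ∘ loc_w`** for the duals (the binder `hsemiD`
of `middleExact_canonical_of_descentData` with `CorGD = globalCorDual`, `CorD v w = localCorDual`):
`localization_cor_eq_sum_localCor` for the module `M^D` and the naturality of localisation in the
coefficients (`galoisCohomology.res_map_one` for `κ⁻¹`).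
[cite: NeukirchSchmidtWingberg2008, I §5 (1.5.6)–(1.5.7)] [cite: SerreGaloisCohomology1997, I §2.4] -/
theorem localization_globalCorDual_eq_sum_localCorDual [Finite M] {p : ℕ} [NeZero p]
    (y' : galoisCohomology (DiscreteGaloisModule.tateDual (ρ.restrictField K') p) 1) :
    galoisCohomology.localization (ρ.tateDual p) (Sum.inr v) 1 (globalCorDual (K' := K') (p := p) ρ y') =
      ∑ w : Place K K' v, localCorDual (p := p) ρ v w
        (galoisCohomology.localization (DiscreteGaloisModule.tateDual (ρ.restrictField K') p)
          (Sum.inr ↑w) 1 y') := by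
  haveI : FiniteDimensional K K' := Module.Finite.of_restrictScalars_finite ℚ K K'
  change galoisCohomology.localization (ρ.tateDual p) (Sum.inr v) 1
    (galoisCohomology.cor (ρ.tateDual p) K' ((dualTransfer (p := p) ρ).symm y')) = _
  rw [localization_cor_eq_sum_localCor]
  refine Finset.sum_congr rfl fun w _ => ?_
  rw [localCorDual_apply, dualTransferLocal_symm_apply]
  congr 1
  exact galoisCohomology.res_map_one ((w : HeightOneSpectrum (𝓞 K')).adicCompletion K')
    (dualKappaInv (K' := K') (p := p) ρ) y'

end SemiLocal

end Summit.BirchSwinnertonDyer.BirchSwinnertonDyer.Theorems.KolyvaginRoadThreePT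

end
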